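import Mathlib
import HarnessLib
import Summits.Ventures.LatticeQCDFlow.Exactness.U1SubstepLogJacobianForce
import Summits.Ventures.LatticeQCDFlow.Exactness.U1SubstepForceBounds

/-!
# `U(1)` rung: TRANSFER OF THE SUP BOUND AND OF THE LIPSCHITZ CONSTANT OF THE EXACT FORCE THROUGH ONE MASKED WILSON-FLOW SUB-STEP — explicit, volume-independent

HONEST FRAMING: exact (Metropolis-corrected) sampling algorithms for lattice gauge theory;
figures of merit are autocorrelation/cost numbers at stated couplings and volumes; no
continuum-physics claim.

Venture `LatticeQCDFlow` (cell pub-lqcd), topic `Exactness`; FANOUT row 14 (`eng-flowhmc`, engine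
`latflow.fthmc`, family B, `U(1)` rung).  NEW WORK of the cell over this row's
`U1SubstepForceChainRule` (`u1ExactForce_comp_substep`), `U1SubstepLogJacobianForce`
(`u1ExactForce_logJacobian`), `U1SubstepForceBounds` (`Σ|M| ≤ 8(d−1)`, `Σ|ΔM| ≤ 32(d−1)·dist`, same
for `N`) and `U1SubstepLipschitz` (`dist(fV, fV') ≤ (1+8(d−1)|ε|)·dist`, `|ΔC| ≤ 8(d−1)·dist`); nothing
is cited as a fact; no number.  Sub-step `f`, field `Z`, factor `C`, booked density `J` VERBATIM as
in `exists_layers_u1WilsonFlowLO`; `g_S(W)(e) = κ · fderiv (p ↦ S(e^(icp)·W)) 0 (δ_e)` the cell's exact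
(autodiff) force of an action `S`.

THE ONE-LAYER STEP OF THE INDUCTION OVER THE MEMBER'S SCHEDULE.  `S'` any action differentiable
along the drift at every field (the action already pulled back through the later layers), with
`|g_(S')| ≤ B` and `|g_(S')(W)(e) − g_(S')(W')(e)| ≤ K·dist(W,W')`; `2(d−1)|ε| < 1`; the new action
`S̃ = S'∘f − log J`.  With `A = 8(d−1)|ε|`, `m = 1 − 2(d−1)|ε|`:

* `u1Factor_ge` — `m ≤ 1 − ε C_e(W)`; `differentiableAt_comp_u1Substep_circleDrift`,
  `differentiableAt_ftAction_u1Substep` — `S'∘f` and `S̃` are differentiable along the drift (so the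
  step can be iterated);
* **`abs_u1ExactForce_substep_le`** — `|g_(S̃)(V)(e')| ≤ B(1 + A) + |κ||c||ε|·8(d−1)/m`;
* **`abs_u1ExactForce_substep_sub_le`** —
  `|g_(S̃)(V)(e') − g_(S̃)(V')(e')| ≤ [K(1+A)² + 32(d−1)|ε|B + |κ||c||ε|(32(d−1)/m + 64(d−1)²|ε|/m²)]·dist(V,V')`.

NOT CLAIMED: sharpness; `SU(2)`; floating point; any number.
-/

noncomputable section

namespace Summit.Ventures.LatticeQCDFlow.Exactness

open Literature.MathematicalPhysics.QuantumFieldTheory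
open scoped BigOperators

variable {d L : ℕ} {X : Type*} [DecidableEq X] (χ : Site d L → X)

/-! ## Real bookkeeping -/

section Real

/-- `|xy − x'y'| ≤ |x − x'|·|y| + |x'|·|y − y'|`. -/
theorem abs_prod_sub_prod_le (x x' y y' : ℝ) : |x * y - x' * y'| ≤ |x - x'| * |y| + |x'| * |y - y'| := by
  have h : x * y - x' * y' = (x - x') * y + x' * (y - y') := by ring
  rw [h, ← abs_mul, ← abs_mul]
  exact abs_add_le _ _

/-- `|Σ xy − Σ x'y'| ≤ B·Σ|x − x'| + G·Σ|x'|` when `|y| ≤ B`, `|y − y'| ≤ G` termwise. -/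
theorem abs_sum_mul_sub_sum_mul_le {ι : Type*} (s : Finset ι) (x x' y y' : ι → ℝ) {B G : ℝ}
    (hy : ∀ i ∈ s, |y i| ≤ B) (hyy : ∀ i ∈ s, |y i - y' i| ≤ G) :
    |∑ i ∈ s, x i * y i - ∑ i ∈ s, x' i * y' i| ≤ B * ∑ i ∈ s, |x i - x' i| + G * ∑ i ∈ s, |x' i| := by
  rw [← Finset.sum_sub_distrib, Finset.mul_sum, Finset.mul_sum, ← Finset.sum_add_distrib]
  refine (Finset.abs_sum_le_sum_abs _ _).trans (Finset.sum_le_sum fun i hi => ?_)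
  refine (abs_prod_sub_prod_le _ _ _ _).trans ?_
  have h1 := mul_le_mul_of_nonneg_left (hy i hi) (abs_nonneg (x i - x' i))
  have h2 := mul_le_mul_of_nonneg_left (hyy i hi) (abs_nonneg (x' i))
  linarith

/-- `|N/D − N'/D'| ≤ |N − N'|/m + |N'|·|D − D'|/m²` for `D, D' ≥ m > 0`. -/
theorem abs_div_sub_div_le_of_le {N N' D D' m : ℝ} (hm : 0 < m) (hD : m ≤ D) (hD' : m ≤ D') :
    |N / D - N' / D'| ≤ |N - N'| / m + |N'| * |D - D'| / m ^ 2 := by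
  have hD0 : 0 < D := hm.trans_le hD
  have hD0' : 0 < D' := hm.trans_le hD'
  have h : N / D - N' / D' = (N - N') / D + N' * (D' - D) / (D * D') := by
    field_simp
    ring
  rw [h]
  refine (abs_add_le _ _).trans (add_le_add ?_ ?_)
  · rw [abs_div, abs_of_pos hD0]
    exact div_le_div_of_nonneg_left (abs_nonneg _) hm hD
  · rw [abs_div, abs_mul, abs_of_pos (mul_pos hD0 hD0'), abs_sub_comm D' D]
    have hDD : m ^ 2 ≤ D * D' := by nlinarith
    exact div_le_div_of_nonneg_left (by positivity) (by positivity) hDD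

end Real

/-! ## Positivity margin of the booked factor and differentiability of the pulled-back action -/

section Prelim

omit [DecidableEq X] in
/-- **`1 − 2(d−1)|ε| ≤ 1 − ε C_e(W)`** at every field. -/
theorem u1Factor_ge (ε : ℝ) (W : GaugeConfig d L Circle) (e : Edge d L) :
    1 - |ε| * (2 * ((d - 1 : ℕ) : ℝ)) ≤ 1 - ε * ∑ ν ∈ Finset.univ.erase e.2,
      (((plaquetteHolonomy W e.1 e.2 ν : Circle) : ℂ).re +
        ((plaquetteHolonomy W (e.1 - Pi.single ν 1) e.2 ν : Circle) : ℂ).re) := by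
  have hC := abs_u1WilsonFlowLOFactorSum_le W e
  have h1 : |ε * ∑ ν ∈ Finset.univ.erase e.2,
      (((plaquetteHolonomy W e.1 e.2 ν : Circle) : ℂ).re +
        ((plaquetteHolonomy W (e.1 - Pi.single ν 1) e.2 ν : Circle) : ℂ).re)| ≤
      |ε| * (2 * ((d - 1 : ℕ) : ℝ)) := by
    rw [abs_mul]
    exact mul_le_mul_of_nonneg_left hC (abs_nonneg ε)
  linarith [(abs_le.mp h1).2]

variable [NeZero L]

/-- `p ↦ S'(f(e^(icp)·V))` is differentiable at `0` whenever `S'` is differentiable along the drift at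
`f(V)` (every `c`; at `c = 0` the map is constant). -/
theorem differentiableAt_comp_u1Substep_circleDrift (μ : Fin d) (b : X) (ε c : ℝ)
    (V : GaugeConfig d L Circle) {S' : GaugeConfig d L Circle → ℝ}
    (hS' : DifferentiableAt ℝ (fun p : Edge d L → ℝ => S' ((fun i : Edge d L => Circle.exp (c * p i)) *
        (fun (V : GaugeConfig d L Circle) (e : Edge d L) => if e.2 = μ ∧ χ e.1 = b then
          V e * Circle.exp (ε * ∑ ν ∈ Finset.univ.erase e.2,
            (((plaquetteHolonomy V (e.1 - Pi.single ν 1) e.2 ν : Circle) : ℂ).im -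
              ((plaquetteHolonomy V e.1 e.2 ν : Circle) : ℂ).im)) else V e) V)) 0) :
    DifferentiableAt ℝ (fun p : Edge d L → ℝ => S' ((fun (V : GaugeConfig d L Circle) (e : Edge d L) =>
        if e.2 = μ ∧ χ e.1 = b then
          V e * Circle.exp (ε * ∑ ν ∈ Finset.univ.erase e.2,
            (((plaquetteHolonomy V (e.1 - Pi.single ν 1) e.2 ν : Circle) : ℂ).im -
              ((plaquetteHolonomy V e.1 e.2 ν : Circle) : ℂ).im)) else V e)
        ((fun i : Edge d L => Circle.exp (c * p i)) * V))) 0 := by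
  by_cases hc : c = 0
  · subst hc
    have h0 : ∀ (p : Edge d L → ℝ) (W : GaugeConfig d L Circle),
        (fun i : Edge d L => Circle.exp (0 * p i)) * W = W := by
      intro p W
      funext i
      simp only [Pi.mul_apply, zero_mul, Circle.exp_zero, one_mul]
    simp only [h0]
    exact differentiableAt_const _
  · exact (hasFDerivAt_comp_u1Substep_circleDrift χ μ b ε hc V hS'.hasFDerivAt).differentiableAt

/-- **`S̃ = S'∘f − log J` is differentiable along the drift at every field** (so the one-layer step
iterates over a schedule). -/
theorem differentiableAt_ftAction_u1Substep (μ : Fin d) (b : X) {ε : ℝ}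
    (hε : |ε| * (2 * ((d - 1 : ℕ) : ℝ)) < 1) (c : ℝ) {S' : GaugeConfig d L Circle → ℝ}
    (hS' : ∀ W : GaugeConfig d L Circle, DifferentiableAt ℝ
      (fun p : Edge d L → ℝ => S' ((fun i : Edge d L => Circle.exp (c * p i)) * W)) 0)
    (V : GaugeConfig d L Circle) :
    DifferentiableAt ℝ (fun p : Edge d L → ℝ =>
      S' ((fun (V : GaugeConfig d L Circle) (e : Edge d L) => if e.2 = μ ∧ χ e.1 = b then
          V e * Circle.exp (ε * ∑ ν ∈ Finset.univ.erase e.2,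
            (((plaquetteHolonomy V (e.1 - Pi.single ν 1) e.2 ν : Circle) : ℂ).im -
              ((plaquetteHolonomy V e.1 e.2 ν : Circle) : ℂ).im)) else V e)
        ((fun i : Edge d L => Circle.exp (c * p i)) * V)) -
      Real.log ((fun V : GaugeConfig d L Circle =>
        ∏ a : {e : Edge d L // e.2 = μ ∧ χ e.1 = b},
          (1 - ε * ∑ ν ∈ Finset.univ.erase a.1.2,
            (((plaquetteHolonomy V a.1.1 a.1.2 ν : Circle) : ℂ).re +
              ((plaquetteHolonomy V (a.1.1 - Pi.single ν 1) a.1.2 ν : Circle) : ℂ).re)))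
        ((fun i : Edge d L => Circle.exp (c * p i)) * V))) 0 :=
  (differentiableAt_comp_u1Substep_circleDrift χ μ b ε c V (hS' _)).sub
    (hasFDerivAt_log_u1Jacobian_circleDrift χ μ b hε c V).differentiableAt

/-- Subtype sums of absolute values are dominated by the sum over all links. -/
theorem sum_subtype_abs_le_univ (μ : Fin d) (b : X) (f : Edge d L → ℝ) :
    ∑ a : {e : Edge d L // e.2 = μ ∧ χ e.1 = b}, |f a.1| ≤ ∑ e : Edge d L, |f e| := by
  classical
  rw [← Finset.sum_subtype (Finset.univ.filter fun e : Edge d L => e.2 = μ ∧ χ e.1 = b)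
    (by simp) (fun e => |f e|)]
  exact Finset.sum_le_univ_sum_of_nonneg fun _ => abs_nonneg _

end Prelim

/-! ## The sup bound through one sub-step -/

section Sup

variable [NeZero L]

/-- **SUP BOUND THROUGH ONE MASKED SUB-STEP**: `|g_(S'∘f − log J)(V)(e')| ≤ B(1 + 8(d−1)|ε|) + |κ||c||ε|·8(d−1)/(1 − 2(d−1)|ε|)`. -/
theorem abs_u1ExactForce_substep_le (μ : Fin d) (b : X) {ε : ℝ}
    (hε : |ε| * (2 * ((d - 1 : ℕ) : ℝ)) < 1) (c κ : ℝ) {S' : GaugeConfig d L Circle → ℝ} {B : ℝ}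
    (hS' : ∀ W : GaugeConfig d L Circle, DifferentiableAt ℝ
      (fun p : Edge d L → ℝ => S' ((fun i : Edge d L => Circle.exp (c * p i)) * W)) 0)
    (hB : ∀ (W : GaugeConfig d L Circle) (e : Edge d L),
      |κ * fderiv ℝ (fun p : Edge d L → ℝ => S' ((fun i : Edge d L => Circle.exp (c * p i)) * W)) 0
        (Pi.single e 1)| ≤ B)
    (V : GaugeConfig d L Circle) (e' : Edge d L) :
    |κ * fderiv ℝ (fun p : Edge d L → ℝ =>
      S' ((fun (V : GaugeConfig d L Circle) (e : Edge d L) => if e.2 = μ ∧ χ e.1 = b then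
          V e * Circle.exp (ε * ∑ ν ∈ Finset.univ.erase e.2,
            (((plaquetteHolonomy V (e.1 - Pi.single ν 1) e.2 ν : Circle) : ℂ).im -
              ((plaquetteHolonomy V e.1 e.2 ν : Circle) : ℂ).im)) else V e)
        ((fun i : Edge d L => Circle.exp (c * p i)) * V)) -
      Real.log ((fun V : GaugeConfig d L Circle =>
        ∏ a : {e : Edge d L // e.2 = μ ∧ χ e.1 = b},
          (1 - ε * ∑ ν ∈ Finset.univ.erase a.1.2,
            (((plaquetteHolonomy V a.1.1 a.1.2 ν : Circle) : ℂ).re +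
              ((plaquetteHolonomy V (a.1.1 - Pi.single ν 1) a.1.2 ν : Circle) : ℂ).re)))
        ((fun i : Edge d L => Circle.exp (c * p i)) * V))) 0 (Pi.single e' 1)| ≤
      B * (1 + 8 * ((d - 1 : ℕ) : ℝ) * |ε|) +
        |κ| * |c| * |ε| * (8 * ((d - 1 : ℕ) : ℝ)) / (1 - |ε| * (2 * ((d - 1 : ℕ) : ℝ))) := by
  classical
  have hB0 : 0 ≤ B := (abs_nonneg _).trans (hB V e')
  have hm : 0 < 1 - |ε| * (2 * ((d - 1 : ℕ) : ℝ)) := by linarith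
  have hd1 := differentiableAt_comp_u1Substep_circleDrift χ μ b ε c V (hS' _)
  have hd2 := (hasFDerivAt_log_u1Jacobian_circleDrift χ μ b hε c V).differentiableAt
  rw [(hd1.hasFDerivAt.fun_sub hd2.hasFDerivAt).fderiv, sub_apply, mul_sub,
    u1ExactForce_comp_substep χ μ b ε c κ V (hS' _) e', u1ExactForce_logJacobian χ μ b hε c κ V e']
  refine (abs_sub _ _).trans (add_le_add ?_ ?_)
  · -- the pulled-back part
    refine (abs_add_le _ _).trans ?_
    have h1 := hB ((fun (V : GaugeConfig d L Circle) (e : Edge d L) => if e.2 = μ ∧ χ e.1 = b then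
          V e * Circle.exp (ε * ∑ ν ∈ Finset.univ.erase e.2,
            (((plaquetteHolonomy V (e.1 - Pi.single ν 1) e.2 ν : Circle) : ℂ).im -
              ((plaquetteHolonomy V e.1 e.2 ν : Circle) : ℂ).im)) else V e) V) e'
    have hM := sum_abs_flowFieldEntry_le V e'
    have h2 : |∑ e ∈ Finset.univ.filter (fun e : Edge d L => e.2 = μ ∧ χ e.1 = b),
        (∑ ν ∈ Finset.univ.erase e.2,
          (((plaquetteHolonomy V (e.1 - Pi.single ν 1) e.2 ν : Circle) : ℂ).re *
              ((Pi.single e' (1 : ℝ) : Edge d L → ℝ) (e.1 - Pi.single ν 1, e.2) +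
                (Pi.single e' (1 : ℝ) : Edge d L → ℝ) ((e.1 - Pi.single ν 1).shift e.2, ν) -
                (Pi.single e' (1 : ℝ) : Edge d L → ℝ) ((e.1 - Pi.single ν 1).shift ν, e.2) -
                (Pi.single e' (1 : ℝ) : Edge d L → ℝ) (e.1 - Pi.single ν 1, ν)) -
            ((plaquetteHolonomy V e.1 e.2 ν : Circle) : ℂ).re *
              ((Pi.single e' (1 : ℝ) : Edge d L → ℝ) (e.1, e.2) +
                (Pi.single e' (1 : ℝ) : Edge d L → ℝ) (e.1.shift e.2, ν) -
                (Pi.single e' (1 : ℝ) : Edge d L → ℝ) (e.1.shift ν, e.2) -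
                (Pi.single e' (1 : ℝ) : Edge d L → ℝ) (e.1, ν)))) *
        (κ * fderiv ℝ (fun p : Edge d L → ℝ => S' ((fun i : Edge d L => Circle.exp (c * p i)) *
          (fun (V : GaugeConfig d L Circle) (e : Edge d L) => if e.2 = μ ∧ χ e.1 = b then
            V e * Circle.exp (ε * ∑ ν ∈ Finset.univ.erase e.2,
              (((plaquetteHolonomy V (e.1 - Pi.single ν 1) e.2 ν : Circle) : ℂ).im -
                ((plaquetteHolonomy V e.1 e.2 ν : Circle) : ℂ).im)) else V e) V)) 0 (Pi.single e 1))| ≤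
        8 * ((d - 1 : ℕ) : ℝ) * B :=
      (Finset.abs_sum_le_sum_abs _ _).trans <|
        (Finset.sum_le_univ_sum_of_nonneg (fun _ => abs_nonneg _)).trans <|
          (Finset.sum_le_sum fun e _ => (abs_mul _ _).trans_le
            (mul_le_mul_of_nonneg_left (hB _ e) (abs_nonneg _))).trans <|
            (Finset.sum_mul _ _ _).symm.le.trans (mul_le_mul_of_nonneg_right hM hB0)
    have h3 := (abs_mul ε _).trans_le (mul_le_mul_of_nonneg_left h2 (abs_nonneg ε))
    calc _ ≤ B + |ε| * (8 * ((d - 1 : ℕ) : ℝ) * B) := add_le_add h1 h3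
      _ = B * (1 + 8 * ((d - 1 : ℕ) : ℝ) * |ε|) := by ring
  · -- the log-Jacobian part
    rw [abs_mul, abs_mul, abs_mul]
    have hN := sum_abs_factorEntry_le V e'
    have hsum : |∑ a : {e : Edge d L // e.2 = μ ∧ χ e.1 = b},
        (∑ ν ∈ Finset.univ.erase a.1.2,
          (((plaquetteHolonomy V a.1.1 a.1.2 ν : Circle) : ℂ).im *
              ((Pi.single e' (1 : ℝ) : Edge d L → ℝ) (a.1.1, a.1.2) +
                (Pi.single e' (1 : ℝ) : Edge d L → ℝ) (a.1.1.shift a.1.2, ν) -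
                (Pi.single e' (1 : ℝ) : Edge d L → ℝ) (a.1.1.shift ν, a.1.2) -
                (Pi.single e' (1 : ℝ) : Edge d L → ℝ) (a.1.1, ν)) +
            ((plaquetteHolonomy V (a.1.1 - Pi.single ν 1) a.1.2 ν : Circle) : ℂ).im *
              ((Pi.single e' (1 : ℝ) : Edge d L → ℝ) (a.1.1 - Pi.single ν 1, a.1.2) +
                (Pi.single e' (1 : ℝ) : Edge d L → ℝ) ((a.1.1 - Pi.single ν 1).shift a.1.2, ν) -
                (Pi.single e' (1 : ℝ) : Edge d L → ℝ) ((a.1.1 - Pi.single ν 1).shift ν, a.1.2) -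
                (Pi.single e' (1 : ℝ) : Edge d L → ℝ) (a.1.1 - Pi.single ν 1, ν)))) /
        (1 - ε * ∑ ν ∈ Finset.univ.erase a.1.2,
            (((plaquetteHolonomy V a.1.1 a.1.2 ν : Circle) : ℂ).re +
              ((plaquetteHolonomy V (a.1.1 - Pi.single ν 1) a.1.2 ν : Circle) : ℂ).re))| ≤
        8 * ((d - 1 : ℕ) : ℝ) / (1 - |ε| * (2 * ((d - 1 : ℕ) : ℝ))) := by
      refine (Finset.abs_sum_le_sum_abs _ _).trans ?_
      have hterm : ∀ a : {e : Edge d L // e.2 = μ ∧ χ e.1 = b},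
          |(∑ ν ∈ Finset.univ.erase a.1.2,
            (((plaquetteHolonomy V a.1.1 a.1.2 ν : Circle) : ℂ).im *
                ((Pi.single e' (1 : ℝ) : Edge d L → ℝ) (a.1.1, a.1.2) +
                  (Pi.single e' (1 : ℝ) : Edge d L → ℝ) (a.1.1.shift a.1.2, ν) -
                  (Pi.single e' (1 : ℝ) : Edge d L → ℝ) (a.1.1.shift ν, a.1.2) -
                  (Pi.single e' (1 : ℝ) : Edge d L → ℝ) (a.1.1, ν)) +
              ((plaquetteHolonomy V (a.1.1 - Pi.single ν 1) a.1.2 ν : Circle) : ℂ).im *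
                ((Pi.single e' (1 : ℝ) : Edge d L → ℝ) (a.1.1 - Pi.single ν 1, a.1.2) +
                  (Pi.single e' (1 : ℝ) : Edge d L → ℝ) ((a.1.1 - Pi.single ν 1).shift a.1.2, ν) -
                  (Pi.single e' (1 : ℝ) : Edge d L → ℝ) ((a.1.1 - Pi.single ν 1).shift ν, a.1.2) -
                  (Pi.single e' (1 : ℝ) : Edge d L → ℝ) (a.1.1 - Pi.single ν 1, ν)))) /
          (1 - ε * ∑ ν ∈ Finset.univ.erase a.1.2,
              (((plaquetteHolonomy V a.1.1 a.1.2 ν : Circle) : ℂ).re +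
                ((plaquetteHolonomy V (a.1.1 - Pi.single ν 1) a.1.2 ν : Circle) : ℂ).re))| ≤
          |∑ ν ∈ Finset.univ.erase a.1.2,
            (((plaquetteHolonomy V a.1.1 a.1.2 ν : Circle) : ℂ).im *
                ((Pi.single e' (1 : ℝ) : Edge d L → ℝ) (a.1.1, a.1.2) +
                  (Pi.single e' (1 : ℝ) : Edge d L → ℝ) (a.1.1.shift a.1.2, ν) -
                  (Pi.single e' (1 : ℝ) : Edge d L → ℝ) (a.1.1.shift ν, a.1.2) -
                  (Pi.single e' (1 : ℝ) : Edge d L → ℝ) (a.1.1, ν)) +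
              ((plaquetteHolonomy V (a.1.1 - Pi.single ν 1) a.1.2 ν : Circle) : ℂ).im *
                ((Pi.single e' (1 : ℝ) : Edge d L → ℝ) (a.1.1 - Pi.single ν 1, a.1.2) +
                  (Pi.single e' (1 : ℝ) : Edge d L → ℝ) ((a.1.1 - Pi.single ν 1).shift a.1.2, ν) -
                  (Pi.single e' (1 : ℝ) : Edge d L → ℝ) ((a.1.1 - Pi.single ν 1).shift ν, a.1.2) -
                  (Pi.single e' (1 : ℝ) : Edge d L → ℝ) (a.1.1 - Pi.single ν 1, ν)))| /
            (1 - |ε| * (2 * ((d - 1 : ℕ) : ℝ))) := by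
        intro a
        have hge := u1Factor_ge ε V a.1
        rw [abs_div, abs_of_pos (hm.trans_le hge)]
        exact div_le_div_of_nonneg_left (abs_nonneg _) hm hge
      refine (Finset.sum_le_sum fun a _ => hterm a).trans ?_
      rw [← Finset.sum_div]
      refine div_le_div_of_nonneg_right ?_ hm.le
      exact (sum_subtype_abs_le_univ χ μ b _).trans hN
    have hk := abs_nonneg κ
    have hc' := abs_nonneg c
    have he := abs_nonneg ε
    calc |κ| * (|c| * (|ε| * _)) ≤ |κ| * (|c| * (|ε| * (8 * ((d - 1 : ℕ) : ℝ) / (1 - |ε| * (2 * ((d - 1 : ℕ) : ℝ)))))) := by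
          gcongr
      _ = |κ| * |c| * |ε| * (8 * ((d - 1 : ℕ) : ℝ)) / (1 - |ε| * (2 * ((d - 1 : ℕ) : ℝ))) := by ring

end Sup

end Summit.Ventures.LatticeQCDFlow.Exactness
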